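import Literature.Geometry.GaugeTheory.BPSTInformationMetric
import HarnessLib

/-!
# The Fisher–Rao form of the BPST family is captured on the balls `B(a, Nλ)`, uniformly in `λ`

Topic `Literature/Geometry/GaugeTheory`; continuation of `BPSTInformationMetric.lean` (the exact
flat-space identity `∫_{ℝ⁴} (∂_{(v,s)}ρ)²/ρ = (128π²/5)(s² + ‖v‖²)/λ²` for the BPST densities
`ρ_{a,λ}(x) = 48λ⁴/(λ² + ‖x − a‖²)⁴`).

Groisser–Murray's interior estimate (1997, §3, proof of Thm. 3.1, Part I) needs the identity in
TRUNCATED form, uniformly in the scale: "we can choose `N` large enough that the integrals from `0`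
to `N` differ from their limiting values by less than `ε/(16·48·2π²)`. Hence
`|∫_{B_{Nλ}(p)} […]² d⁴x − ‖(a₀,𝐚)‖²_hyp| ≤ ε ‖(a₀,𝐚)‖²_hyp`".  This file proves exactly
that, in flat `ℝ⁴`:

* `fisherRao_integrand_eq` / `fisherRao_integrand_le`: the integrand
  `768 λ²(s(r²−λ²) + 2λ⟪y,v⟫)²/(λ²+r²)⁶` and its radial domination
  `≤ 1536 λ²(s²/(λ²+r²)⁴ + 4λ²‖v‖² r²/(λ²+r²)⁶)`;
* `integrable_fisherRao_bpstDensity`: integrability on `ℝ⁴`;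
* `setIntegral_fisherRao_bpstDensity_compl_ball_le`: the tail outside `B(a, Nλ)` is
  `≤ 3072π²(s² + ‖v‖²)/(λ²N⁴)` for `N ≥ 1` (scale invariance: the bound is `120/N⁴` times the
  hyperbolic norm `(128π²/5)(s² + ‖v‖²)/λ²`);
* `setIntegral_fisherRao_bpstDensity_ball` (that display, flat): `∀ ε > 0 ∃ N ≥ 1 ∀ a, λ > 0, v, s`,
  `|∫_{B(a,Nλ)} (∂ρ)²/ρ − (128π²/5)(s²+‖v‖²)/λ²| ≤ ε (128π²/5)(s²+‖v‖²)/λ²`;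

with the radial tail integral `∫_{‖y‖ ≥ R} ‖y‖⁻⁸ d⁴y = π²/(2R⁴)` (`BPST.integral_indicator_tail`),
and, by the same domination, the **concentration of the action**
`setIntegral_bpstDensity_compl_ball_le`: `∫_{‖x−a‖ ≥ Nλ} ρ_{a,λ} ≤ 24π²/N⁴` of the total `8π²`
(the flat `k = 0` case of GM's exterior bound `‖r^k F_A‖_{L²(Ω)} ≤ c(k) λ^k N^{k−2}`).

What is NOT here: the curved-space comparison (normal coordinates, `O(r²)` metric error) and the
`C^k`-closeness input (Donaldson 1983, Thm. 16) that turn this into GM's interior estimate on `M`.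

## References

* [GroisserMurray1997] D. Groisser, M. K. Murray, *Instantons and the information metric*, Ann.
  Global Anal. Geom. 15 (1997) 519–537 (dg-ga/9611008), §3, proof of Thm. 3.1, Part I (interior
  estimates) and the exterior `L²(Ω)` bounds.
-/

noncomputable section

open scoped RealInnerProductSpace
open Set Filter Real
open _root_.MeasureTheory _root_.Topology

namespace Literature.Geometry.GaugeTheory

/-- Local notation: the model space `ℝ⁴`. -/
local notation "E4" => EuclideanSpace ℝ (Fin 4)

open BPST

/-! ### Truncation to the balls `B(a, Nλ)` (Groisser–Murray 1997, proof of Thm. 3.1, flat case) -/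

namespace BPST

/-- `∫_R^∞ r³ · r⁻⁸ dr = 1/(4R⁴)` for `R > 0`. [folklore] -/
theorem integral_Ioi_tail {R : ℝ} (hR : 0 < R) :
    ∫ r in Ioi R, r ^ 3 * (r ^ 8)⁻¹ = 1 / (4 * R ^ 4) := by
  have hderiv : ∀ r ∈ Ici R, HasDerivAt (fun r : ℝ ↦ -(r ^ 4)⁻¹ / 4) (r ^ 3 * (r ^ 8)⁻¹) r := by
    intro r hr
    have hr0 : r ≠ 0 := (hR.trans_le hr).ne'
    refine (((hasDerivAt_pow 4 r).fun_inv (pow_ne_zero 4 hr0)).fun_neg.div_const 4).congr_deriv ?_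
    norm_num
    field_simp
  have h4 : Tendsto (fun r : ℝ ↦ (r ^ 4)⁻¹) atTop (𝓝 0) :=
    tendsto_inv_atTop_zero.comp (tendsto_pow_atTop four_ne_zero)
  have hlim : Tendsto (fun r : ℝ ↦ -(r ^ 4)⁻¹ / 4) atTop (𝓝 0) := by
    simpa using h4.neg.div_const 4
  rw [integral_Ioi_of_hasDerivAt_of_nonneg' hderiv
    (fun r hr ↦ by have := hR.trans hr; positivity) hlim]
  field_simp
  ring

/-- `r³ · r⁻⁸` is integrable on `(R, ∞)` for `R > 0`. [folklore] -/
theorem integrableOn_Ioi_tail {R : ℝ} (hR : 0 < R) :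
    IntegrableOn (fun r : ℝ ↦ r ^ 3 * (r ^ 8)⁻¹) (Ioi R) := by
  have hderiv : ∀ r ∈ Ici R, HasDerivAt (fun r : ℝ ↦ -(r ^ 4)⁻¹ / 4) (r ^ 3 * (r ^ 8)⁻¹) r := by
    intro r hr
    have hr0 : r ≠ 0 := (hR.trans_le hr).ne'
    refine (((hasDerivAt_pow 4 r).fun_inv (pow_ne_zero 4 hr0)).fun_neg.div_const 4).congr_deriv ?_
    norm_num
    field_simp
  have h4 : Tendsto (fun r : ℝ ↦ (r ^ 4)⁻¹) atTop (𝓝 0) :=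
    tendsto_inv_atTop_zero.comp (tendsto_pow_atTop four_ne_zero)
  have hlim : Tendsto (fun r : ℝ ↦ -(r ^ 4)⁻¹ / 4) atTop (𝓝 0) := by
    simpa using h4.neg.div_const 4
  exact integrableOn_Ioi_deriv_of_nonneg' hderiv (fun r hr ↦ by have := hR.trans hr; positivity) hlim

/-- The radial tail profile `r ↦ 1_{[R,∞)}(r) r⁻⁸`, `R > 0`, gives an integrable function of `‖y‖`
on `ℝ⁴`. [folklore] -/
theorem integrable_indicator_tail {R : ℝ} (hR : 0 < R) :
    Integrable (fun y : E4 ↦ (Ici R).indicator (fun r : ℝ ↦ (r ^ 8)⁻¹) ‖y‖) := by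
  rw [integrable_radial_four_iff]
  have heq : (fun r : ℝ ↦ r ^ 3 * (Ici R).indicator (fun r : ℝ ↦ (r ^ 8)⁻¹) r) =
      (Ici R).indicator (fun r : ℝ ↦ r ^ 3 * (r ^ 8)⁻¹) := by
    funext r
    rw [Set.indicator_mul_right]
  rw [heq]
  exact ((integrable_indicator_iff measurableSet_Ici).2
    (Iff.mpr integrableOn_Ici_iff_integrableOn_Ioi (integrableOn_Ioi_tail hR))).integrableOn

/-- `∫_{‖y‖ ≥ R} ‖y‖⁻⁸ d⁴y = π²/(2R⁴)`. [folklore] -/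
theorem integral_indicator_tail {R : ℝ} (hR : 0 < R) :
    ∫ y : E4, (Ici R).indicator (fun r : ℝ ↦ (r ^ 8)⁻¹) ‖y‖ = π ^ 2 / (2 * R ^ 4) := by
  rw [integral_radial_four ((Ici R).indicator fun r : ℝ ↦ (r ^ 8)⁻¹)]
  have heq : (fun r : ℝ ↦ r ^ 3 * (Ici R).indicator (fun r : ℝ ↦ (r ^ 8)⁻¹) r) =
      (Ici R).indicator (fun r : ℝ ↦ r ^ 3 * (r ^ 8)⁻¹) := by
    funext r
    rw [Set.indicator_mul_right]
  rw [heq, setIntegral_indicator measurableSet_Ici,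
    Set.inter_eq_right.2 (Ici_subset_Ioi.2 hR), integral_Ici_eq_integral_Ioi, integral_Ioi_tail hR]
  field_simp
  ring

end BPST

/-- **Concentration of the instanton action (GM's exterior bound, `k = 0`, flat):** outside the ball
`B(a, Nl)` the BPST density has mass at most `24π²/N⁴` (of the total `8π²`), for every `N > 0`:
`ρ ≤ 48 l⁴ r⁻⁸` there and `∫_{r ≥ Nl} r⁻⁸ d⁴y = π²/(2N⁴l⁴)`.
[cite: GroisserMurray1997, §3, proof of Thm. 3.1, exterior estimates] -/
theorem setIntegral_bpstDensity_compl_ball_le (a : E4) {l : ℝ} (hl : 0 < l) {N : ℝ} (hN : 0 < N) :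
    ∫ x in (Metric.ball a (N * l))ᶜ, bpstDensity a l x ≤ 24 * π ^ 2 / N ^ 4 := by
  have hNl : 0 < N * l := mul_pos hN hl
  set G : E4 → ℝ := fun x ↦ 48 * l ^ 4 * (Ici (N * l)).indicator (fun r : ℝ ↦ (r ^ 8)⁻¹) ‖x - a‖
    with hG
  have hGi : Integrable G := ((integrable_indicator_tail hNl).comp_sub_right a).const_mul (48 * l ^ 4)
  have hG0 : ∀ x, 0 ≤ G x := fun x ↦
    mul_nonneg (by positivity) (Set.indicator_nonneg (fun r _ ↦ by positivity) _)
  have hGint : ∫ x, G x = 48 * l ^ 4 * (π ^ 2 / (2 * (N * l) ^ 4)) := by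
    simp only [hG]
    rw [integral_const_mul]
    congr 1
    have htr := integral_sub_right_eq_self (μ := (volume : Measure E4))
      (fun y : E4 ↦ (Ici (N * l)).indicator (fun r : ℝ ↦ (r ^ 8)⁻¹) ‖y‖) a
    rw [htr, BPST.integral_indicator_tail hNl]
  have hρi : Integrable (fun x : E4 ↦ bpstDensity a l x) :=
    Integrable.of_integral_ne_zero (by rw [integral_bpstDensity a hl]; positivity)
  have hdom : ∀ x ∈ (Metric.ball a (N * l))ᶜ, bpstDensity a l x ≤ G x := by
    intro x hx
    rw [Set.mem_compl_iff, Metric.mem_ball, dist_eq_norm, not_lt] at hx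
    have hr : 0 < ‖x - a‖ := hNl.trans_le hx
    simp only [hG, Set.indicator_of_mem (show ‖x - a‖ ∈ Ici (N * l) from hx), bpstDensity]
    rw [← div_eq_mul_inv]
    refine div_le_div_of_nonneg_left (by positivity) (by positivity) ?_
    calc ‖x - a‖ ^ 8 = (‖x - a‖ ^ 2) ^ 4 := by ring
      _ ≤ (l ^ 2 + ‖x - a‖ ^ 2) ^ 4 := pow_le_pow_left₀ (sq_nonneg _) (by nlinarith) 4
  have hl0 : l ≠ 0 := hl.ne'
  have hN0 : N ≠ 0 := hN.ne'
  calc ∫ x in (Metric.ball a (N * l))ᶜ, bpstDensity a l x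
      ≤ ∫ x in (Metric.ball a (N * l))ᶜ, G x :=
        setIntegral_mono_on hρi.integrableOn hGi.integrableOn
          Metric.isOpen_ball.measurableSet.compl hdom
    _ ≤ ∫ x, G x := setIntegral_le_integral hGi (ae_of_all _ hG0)
    _ = 48 * l ^ 4 * (π ^ 2 / (2 * (N * l) ^ 4)) := hGint
    _ = 24 * π ^ 2 / N ^ 4 := by
        field_simp
        ring

/-- **The Fisher–Rao integrand of the BPST family, explicitly:** with `y = x − a`,
`(∂_{(v,s)}ρ)²/ρ = 768 l² (s(‖y‖² − l²) + 2l⟪y, v⟫)²/(l² + ‖y‖²)⁶`. [folklore] -/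
theorem fisherRao_integrand_eq (a : E4) {l : ℝ} (hl : l ≠ 0) (x v : E4) (s : ℝ) :
    (fderiv ℝ (fun p : E4 × ℝ ↦ bpstDensity p.1 p.2 x) (a, l) (v, s)) ^ 2 / bpstDensity a l x =
      768 * l ^ 2 * (s * (‖x - a‖ ^ 2 - l ^ 2) + 2 * l * ⟪x - a, v⟫) ^ 2 / (l ^ 2 + ‖x - a‖ ^ 2) ^ 6 := by
  rw [fderiv_bpstDensity a hl x v s, bpstDensity_apply]
  have hu : l ^ 2 + ‖x - a‖ ^ 2 ≠ 0 := by positivity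
  field_simp
  ring

/-- **Radial domination of the Fisher–Rao integrand:**
`(∂_{(v,s)}ρ)²/ρ ≤ 1536 l² (s²/(l²+r²)⁴ + 4l²‖v‖² r²/(l²+r²)⁶)`, `r = ‖x − a‖`
(from `(P+Q)² ≤ 2P² + 2Q²`, `(r²−l²)² ≤ (r²+l²)²` and Cauchy–Schwarz). [folklore] -/
theorem fisherRao_integrand_le (a : E4) {l : ℝ} (hl : 0 < l) (x v : E4) (s : ℝ) :
    (fderiv ℝ (fun p : E4 × ℝ ↦ bpstDensity p.1 p.2 x) (a, l) (v, s)) ^ 2 / bpstDensity a l x ≤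
      1536 * l ^ 2 * (s ^ 2 / (l ^ 2 + ‖x - a‖ ^ 2) ^ 4 +
        4 * l ^ 2 * ‖v‖ ^ 2 * (((l ^ 2 + ‖x - a‖ ^ 2) ^ 6)⁻¹ * ‖x - a‖ ^ 2)) := by
  rw [fisherRao_integrand_eq a hl.ne' x v s]
  set y := x - a
  have hu : 0 < l ^ 2 + ‖y‖ ^ 2 := by positivity
  have hcs : ⟪y, v⟫ ^ 2 ≤ ‖y‖ ^ 2 * ‖v‖ ^ 2 := by
    rw [← sq_abs, ← mul_pow]
    exact pow_le_pow_left₀ (abs_nonneg _) (abs_real_inner_le_norm y v) 2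
  have hsq : (s * (‖y‖ ^ 2 - l ^ 2) + 2 * l * ⟪y, v⟫) ^ 2 ≤
      2 * (s ^ 2 * (l ^ 2 + ‖y‖ ^ 2) ^ 2) + 8 * (l ^ 2 * (‖y‖ ^ 2 * ‖v‖ ^ 2)) := by
    nlinarith [sq_nonneg (s * (‖y‖ ^ 2 - l ^ 2) - 2 * l * ⟪y, v⟫), sq_nonneg s, sq_nonneg l,
      mul_nonneg (mul_nonneg (sq_nonneg s) (sq_nonneg l)) (sq_nonneg ‖y‖),
      mul_le_mul_of_nonneg_left hcs (sq_nonneg l)]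
  calc 768 * l ^ 2 * (s * (‖y‖ ^ 2 - l ^ 2) + 2 * l * ⟪y, v⟫) ^ 2 / (l ^ 2 + ‖y‖ ^ 2) ^ 6
      ≤ 768 * l ^ 2 * (2 * (s ^ 2 * (l ^ 2 + ‖y‖ ^ 2) ^ 2) + 8 * (l ^ 2 * (‖y‖ ^ 2 * ‖v‖ ^ 2))) /
          (l ^ 2 + ‖y‖ ^ 2) ^ 6 := by gcongr
    _ = 1536 * l ^ 2 * (s ^ 2 / (l ^ 2 + ‖y‖ ^ 2) ^ 4 +
          4 * l ^ 2 * ‖v‖ ^ 2 * (((l ^ 2 + ‖y‖ ^ 2) ^ 6)⁻¹ * ‖y‖ ^ 2)) := by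
        field_simp
        ring

/-- **The Fisher–Rao integrand of the BPST family is integrable on `ℝ⁴`** (dominated by the radial
profile of `fisherRao_integrand_le`). [folklore] -/
theorem integrable_fisherRao_bpstDensity (a : E4) {l : ℝ} (hl : 0 < l) (v : E4) (s : ℝ) :
    Integrable (fun x : E4 ↦
      (fderiv ℝ (fun p : E4 × ℝ ↦ bpstDensity p.1 p.2 x) (a, l) (v, s)) ^ 2 / bpstDensity a l x) := by
  -- the dominating radial profile is integrable
  have hD : Integrable (fun y : E4 ↦ 1536 * l ^ 2 * (s ^ 2 / (l ^ 2 + ‖y‖ ^ 2) ^ 4 +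
      4 * l ^ 2 * ‖v‖ ^ 2 * (((l ^ 2 + ‖y‖ ^ 2) ^ 6)⁻¹ * ‖y‖ ^ 2))) := by
    have h := (integrable_radial_four_iff (fun r ↦ 1536 * l ^ 2 * (s ^ 2 / (l ^ 2 + r ^ 2) ^ 4 +
      4 * l ^ 2 * ‖v‖ ^ 2 * (((l ^ 2 + r ^ 2) ^ 6)⁻¹ * r ^ 2)))).2
    refine h ?_
    have hsum : IntegrableOn (fun r : ℝ ↦ 1536 * l ^ 2 * s ^ 2 * (r ^ 3 / (l ^ 2 + r ^ 2) ^ 4) +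
        1536 * l ^ 2 * (4 * l ^ 2 * ‖v‖ ^ 2) * (r ^ 3 * (((l ^ 2 + r ^ 2) ^ 6)⁻¹ * r ^ 2))) (Ioi 0) :=
      ((integrableOn_mass hl).const_mul (1536 * l ^ 2 * s ^ 2)).add
        ((integrableOn_moment hl).const_mul (1536 * l ^ 2 * (4 * l ^ 2 * ‖v‖ ^ 2)))
    refine hsum.congr_fun (fun r _ ↦ ?_) measurableSet_Ioi
    ring
  have hDa := hD.comp_sub_right a
  -- continuity of the integrand, through its explicit form
  have hcont : Continuous fun x : E4 ↦
      768 * l ^ 2 * (s * (‖x - a‖ ^ 2 - l ^ 2) + 2 * l * ⟪x - a, v⟫) ^ 2 / (l ^ 2 + ‖x - a‖ ^ 2) ^ 6 := by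
    refine Continuous.div (by fun_prop) (by fun_prop) fun x ↦ ?_
    positivity
  refine hDa.mono' ?_ (ae_of_all _ fun x ↦ ?_)
  · exact (hcont.congr fun x ↦ (fisherRao_integrand_eq a hl.ne' x v s).symm).aestronglyMeasurable
  · rw [Real.norm_eq_abs, abs_of_nonneg (div_nonneg (sq_nonneg _) (bpstDensity_pos a hl.ne' x).le)]
    exact fisherRao_integrand_le a hl x v s

/-- **Tail estimate:** for `N ≥ 1` and `l > 0`, the Fisher–Rao integrand has mass at most
`3072π² (s² + ‖v‖²)/(l² N⁴)` outside the ball `B(a, Nl)` (the integrand is `≤ 1536 l²(s² + 4‖v‖²) r⁻⁸`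
there and `∫_{r ≥ Nl} r⁻⁸ d⁴y = π²/(2N⁴l⁴)`). [folklore] -/
theorem setIntegral_fisherRao_bpstDensity_compl_ball_le (a : E4) {l : ℝ} (hl : 0 < l) (v : E4) (s : ℝ)
    {N : ℝ} (hN : 1 ≤ N) :
    ∫ x in (Metric.ball a (N * l))ᶜ,
        (fderiv ℝ (fun p : E4 × ℝ ↦ bpstDensity p.1 p.2 x) (a, l) (v, s)) ^ 2 / bpstDensity a l x ≤
      3072 * π ^ 2 * (s ^ 2 + ‖v‖ ^ 2) / (l ^ 2 * N ^ 4) := by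
  have hNl : 0 < N * l := mul_pos (by linarith) hl
  set K : ℝ := 1536 * l ^ 2 * (s ^ 2 + 4 * ‖v‖ ^ 2) with hK
  have hK0 : 0 ≤ K := by positivity
  -- the dominating function `K · 1_{r ≥ Nl} r⁻⁸`, translated to `a`
  set G : E4 → ℝ := fun x ↦ K * (Ici (N * l)).indicator (fun r : ℝ ↦ (r ^ 8)⁻¹) ‖x - a‖ with hG
  have hGi : Integrable G := ((integrable_indicator_tail hNl).comp_sub_right a).const_mul K
  have hG0 : ∀ x, 0 ≤ G x := fun x ↦
    mul_nonneg hK0 (Set.indicator_nonneg (fun r _ ↦ by positivity) _)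
  have hGint : ∫ x, G x = K * (π ^ 2 / (2 * (N * l) ^ 4)) := by
    simp only [hG]
    rw [integral_const_mul]
    congr 1
    have htr := integral_sub_right_eq_self (μ := (volume : Measure E4))
      (fun y : E4 ↦ (Ici (N * l)).indicator (fun r : ℝ ↦ (r ^ 8)⁻¹) ‖y‖) a
    rw [htr, BPST.integral_indicator_tail hNl]
  -- pointwise domination on the complement of the ball
  have hdom : ∀ x ∈ (Metric.ball a (N * l))ᶜ,
      (fderiv ℝ (fun p : E4 × ℝ ↦ bpstDensity p.1 p.2 x) (a, l) (v, s)) ^ 2 / bpstDensity a l x ≤ G x := by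
    intro x hx
    rw [Set.mem_compl_iff, Metric.mem_ball, dist_eq_norm, not_lt] at hx
    have hr : 0 < ‖x - a‖ := hNl.trans_le hx
    have hlr : l ≤ ‖x - a‖ := le_trans (by nlinarith) hx
    simp only [hG, Set.indicator_of_mem (show ‖x - a‖ ∈ Ici (N * l) from hx)]
    refine (fisherRao_integrand_le a hl x v s).trans ?_
    set r := ‖x - a‖
    have h1 : s ^ 2 / (l ^ 2 + r ^ 2) ^ 4 ≤ s ^ 2 * (r ^ 8)⁻¹ := by
      rw [← div_eq_mul_inv]
      refine div_le_div_of_nonneg_left (sq_nonneg s) (by positivity) ?_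
      calc r ^ 8 = (r ^ 2) ^ 4 := by ring
        _ ≤ (l ^ 2 + r ^ 2) ^ 4 := pow_le_pow_left₀ (sq_nonneg r) (by nlinarith) 4
    have h2 : 4 * l ^ 2 * ‖v‖ ^ 2 * (((l ^ 2 + r ^ 2) ^ 6)⁻¹ * r ^ 2) ≤ 4 * ‖v‖ ^ 2 * (r ^ 8)⁻¹ := by
      have hr8 : 0 < r ^ 8 := by positivity
      have hu6 : 0 < (l ^ 2 + r ^ 2) ^ 6 := by positivity
      rw [show 4 * l ^ 2 * ‖v‖ ^ 2 * (((l ^ 2 + r ^ 2) ^ 6)⁻¹ * r ^ 2) =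
          4 * ‖v‖ ^ 2 * (l ^ 2 * r ^ 2 / (l ^ 2 + r ^ 2) ^ 6) by ring,
        show 4 * ‖v‖ ^ 2 * (r ^ 8)⁻¹ = 4 * ‖v‖ ^ 2 * (1 / r ^ 8) by ring]
      refine mul_le_mul_of_nonneg_left ?_ (by positivity)
      rw [div_le_div_iff₀ hu6 hr8, one_mul]
      calc l ^ 2 * r ^ 2 * r ^ 8 ≤ r ^ 2 * r ^ 2 * r ^ 8 := by gcongr
        _ = (r ^ 2) ^ 6 := by ring
        _ ≤ (l ^ 2 + r ^ 2) ^ 6 := pow_le_pow_left₀ (sq_nonneg r) (by nlinarith) 6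
    calc 1536 * l ^ 2 * (s ^ 2 / (l ^ 2 + r ^ 2) ^ 4 + 4 * l ^ 2 * ‖v‖ ^ 2 * (((l ^ 2 + r ^ 2) ^ 6)⁻¹ * r ^ 2))
        ≤ 1536 * l ^ 2 * (s ^ 2 * (r ^ 8)⁻¹ + 4 * ‖v‖ ^ 2 * (r ^ 8)⁻¹) := by gcongr
      _ = K * (r ^ 8)⁻¹ := by simp only [hK]; ring
  -- integrate
  calc ∫ x in (Metric.ball a (N * l))ᶜ,
        (fderiv ℝ (fun p : E4 × ℝ ↦ bpstDensity p.1 p.2 x) (a, l) (v, s)) ^ 2 / bpstDensity a l x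
      ≤ ∫ x in (Metric.ball a (N * l))ᶜ, G x :=
        setIntegral_mono_on (integrable_fisherRao_bpstDensity a hl v s).integrableOn hGi.integrableOn
          Metric.isOpen_ball.measurableSet.compl hdom
    _ ≤ ∫ x, G x := setIntegral_le_integral hGi (ae_of_all _ hG0)
    _ = K * (π ^ 2 / (2 * (N * l) ^ 4)) := hGint
    _ ≤ 3072 * π ^ 2 * (s ^ 2 + ‖v‖ ^ 2) / (l ^ 2 * N ^ 4) := by
        have hl0 : l ≠ 0 := hl.ne'
        have hN0 : 0 < N := by linarith
        rw [show K * (π ^ 2 / (2 * (N * l) ^ 4)) = 768 * π ^ 2 * (s ^ 2 + 4 * ‖v‖ ^ 2) / (l ^ 2 * N ^ 4) by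
          simp only [hK]; field_simp; ring]
        apply div_le_div_of_nonneg_right _ (by positivity)
        nlinarith [mul_nonneg (sq_nonneg π) (sq_nonneg s)]

/-- **Groisser–Murray's truncation, flat case: the information metric is captured on the balls
`B(a, Nλ)` uniformly in the scale.** For every `ε > 0` there is `N ≥ 1` such that for all centres
`a`, scales `l > 0` and tangent vectors `(v, s)`,
`|∫_{B(a,Nl)} (∂_{(v,s)}ρ)²/ρ d⁴x − (128π²/5)(s² + ‖v‖²)/l²| ≤ ε · (128π²/5)(s² + ‖v‖²)/l²`
(GM 1997, proof of Thm. 3.1, Part I: "we can choose `N` large enough that the integrals from `0` to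
`N` differ from their limiting values by less than `ε/(16·48·2π²)`. Hence
`|∫_{B_{Nλ}(p)} […]² d⁴x − ‖(a₀,𝐚)‖²_hyp| ≤ ε ‖(a₀,𝐚)‖²_hyp`"). [cite: GroisserMurray1997, §3, proof of Thm. 3.1, Part I] -/
theorem setIntegral_fisherRao_bpstDensity_ball {ε : ℝ} (hε : 0 < ε) :
    ∃ N : ℝ, 1 ≤ N ∧ ∀ (a : E4) (l : ℝ), 0 < l → ∀ (v : E4) (s : ℝ),
      |(∫ x in Metric.ball a (N * l),
          (fderiv ℝ (fun p : E4 × ℝ ↦ bpstDensity p.1 p.2 x) (a, l) (v, s)) ^ 2 / bpstDensity a l x) -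
          128 * π ^ 2 / 5 * (s ^ 2 + ‖v‖ ^ 2) / l ^ 2|
        ≤ ε * (128 * π ^ 2 / 5 * (s ^ 2 + ‖v‖ ^ 2) / l ^ 2) := by
  refine ⟨1 + 120 / ε, by have := div_pos (by norm_num : (0 : ℝ) < 120) hε; linarith, ?_⟩
  intro a l hl v s
  set N : ℝ := 1 + 120 / ε with hNdef
  have hN1 : 1 ≤ N := by have := div_pos (by norm_num : (0 : ℝ) < 120) hε; simp only [hNdef]; linarith
  have hN4 : 120 / ε ≤ N ^ 4 := by
    calc 120 / ε ≤ N := by simp only [hNdef]; linarith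
      _ ≤ N ^ 4 := le_self_pow₀ hN1 four_ne_zero
  set F : E4 → ℝ := fun x ↦
    (fderiv ℝ (fun p : E4 × ℝ ↦ bpstDensity p.1 p.2 x) (a, l) (v, s)) ^ 2 / bpstDensity a l x with hF
  have hFi : Integrable F := integrable_fisherRao_bpstDensity a hl v s
  have htot : ∫ x, F x = 128 * π ^ 2 / 5 * (s ^ 2 + ‖v‖ ^ 2) / l ^ 2 :=
    integral_fisherRao_bpstDensity a hl v s
  have hsplit := integral_add_compl (μ := (volume : Measure E4)) Metric.isOpen_ball.measurableSet hFi
    (s := Metric.ball a (N * l))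
  have htail := setIntegral_fisherRao_bpstDensity_compl_ball_le a hl v s hN1
  have htail0 : 0 ≤ ∫ x in (Metric.ball a (N * l))ᶜ, F x :=
    setIntegral_nonneg Metric.isOpen_ball.measurableSet.compl
      fun x _ ↦ div_nonneg (sq_nonneg _) (bpstDensity_pos a hl.ne' x).le
  have hkey : (∫ x in Metric.ball a (N * l), F x) - 128 * π ^ 2 / 5 * (s ^ 2 + ‖v‖ ^ 2) / l ^ 2 =
      -∫ x in (Metric.ball a (N * l))ᶜ, F x := by linarith
  rw [hkey, abs_neg, abs_of_nonneg htail0]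
  refine htail.trans ?_
  -- `3072 π² S/(l² N⁴) ≤ ε · (128π²/5) S/l²  ⇐  120 ≤ ε N⁴`
  have h1 : 120 ≤ ε * N ^ 4 := by rwa [div_le_iff₀' hε] at hN4
  have hN0 : 0 < N := by linarith
  have hl0 : l ≠ 0 := hl.ne'
  rw [show 3072 * π ^ 2 * (s ^ 2 + ‖v‖ ^ 2) / (l ^ 2 * N ^ 4) =
      (3072 / N ^ 4) * (π ^ 2 * (s ^ 2 + ‖v‖ ^ 2) / l ^ 2) by field_simp,
    show ε * (128 * π ^ 2 / 5 * (s ^ 2 + ‖v‖ ^ 2) / l ^ 2) =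
      (ε * (128 / 5)) * (π ^ 2 * (s ^ 2 + ‖v‖ ^ 2) / l ^ 2) by ring]
  refine mul_le_mul_of_nonneg_right ?_ (by positivity)
  rw [div_le_iff₀ (by positivity)]
  linarith [h1]

end Literature.Geometry.GaugeTheory

end
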